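import Summits.QuantumFields.BalabanUV.Beta.GAN24.StaircaseLineSumDefect
import Summits.QuantumFields.BalabanUV.T4Continuum.Support.LineAveragingPairing

/-!
# G-an2-4 ∕ (CONV-C), road P2, route R2-S1 («intertwining census»), VECTOR LAYER, PART 2 — BAŁABAN's VECTOR AVERAGING `Q_k` (1.18)
# AND ITS ADJOINT `Q_k*` AGAINST THE COMPONENTWISE STAIRCASE `J ⊗ 1`: the two EXACT defects `E₁ := Q_{RN}·(J⊗1) − Q_N` (forward) and
# `E₂ := Q*_{RN} − (J⊗1)·Q*_N` (adjoint) as MATRICES, their position-space forms, and their sizes `≤ (R−1)∕(RN)`, `≤ 2(R−1)∕(RN)` in sup norm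

Unit `b2b-balaban-gan24-p2` (gen 30), BINDER row G-an2-4 ∕ (CONV-C), road P2; crux team (2).  The scalar block mean `Q′` intertwines with
King's staircase exactly (`HardMinimiserOneStepSup.QsOp_mul_stair`); Bałaban's averaging of VECTOR fields (1.18) — block mean of straight
contour sums, `B5Block118.QvOp`, adjoint `Q* = n^d·Qᴴ` = `B5DeltaA169.QvAdj` — does NOT.  Part 1 (`StaircaseLineSumDefect`, gen 29) computed
the ADJOINT defect pointwise (`QvAdj_succ_sub_stair`, a sawtooth of size `π^F`); the FORWARD defect is NE2 leaf-06's pairing identity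
`LineAveragingPairing.sqrt_smul_QvOp_mul_JK` (`√(R^d)·Q_{RN}J_R = Q_N(1 + c_R(S₁ − 1))`, `c_R = (R−1)∕(2R)`, `S₁` the own-direction fine
shift) read through `√(R^d)·J_R = J ⊗ 1`.  THIS FILE packages both as the two matrices the vector two-level identity
(`AveragedPropagatorTwoLevel`, next file) is written in:
 * §1 **`stairV N R M`** — the componentwise staircase `(J⊗1)u (x′, μ) = u(par x′, μ)` as a `0∕1` matrix; `stairV_mulVec`; `stairV_eq_smul_JK`
   (`= √(R^d)·JK`, King's injection un-normalised);
 * §2 **`fwdDefect N R M := QvOp (R*N) M * stairV N R M − QvOp N M`**; **`fwdDefect_eq`** `= c_R • Q_N(S₁ − 1)` (BY NAME from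
   `sqrt_smul_QvOp_mul_JK`); **`fwdDefect_mulVec_apply`** — the telescoped position-space form
   `(E₁f)_μ(y) = c_R·N^{−(d+1)}·Σ_{x ∈ B_N(y)} (f_μ(x + N e_μ) − f_μ(x))` (`lineSum_shiftT_sub`: the contour sum of `S₁f − f` telescopes to a
   UNIT-distance difference); **`norm_fwdDefect_mulVec_le`**: `|E₁f| ≤ ((R−1)∕(RN))·|f|_∞`;
 * §3 **`adjDefect N R M := QvAdj (R*N) M − stairV N R M * QvAdj N M`**; `adjDefect_mulVec_apply` (= Part 1's sawtooth
   `π^F_μ(x′)·(B_μ(y) − B_μ(y − e_μ))`); **`norm_adjDefect_mulVec_le`**: `|E₂B| ≤ 2((R−1)∕(RN))·|B|_∞`;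
 * §4 the elementary sup bounds **`norm_QvOp_mulVec_le`** `|Q f| ≤ |f|_∞`, **`norm_QvAdj_mulVec_le`** `|Q* B| ≤ |B|_∞`, `norm_stairV_mulVec_le`;
 * §5 **`Pi_stairV_defect`**: `Q′*Q′·(J⊗1) − (J⊗1)·Q*Q = E₂·Q + Q′*·E₁` — the two-level defect of the mass term `aQ*Q` of Bałaban's `Δ_a`
   (1.69) in terms of the two averaging defects (pure algebra).
HONEST SCOPE.  Exact finite-lattice algebra and triangle inequalities at `U = 1`, every `d`, `N, R ≥ 1`, every torus `M`; [folklore],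
kernel-checked, no `sorry`, no `def … : Prop`; the forward identity is NE2 leaf-06's BY NAME.  [Balaban1984PropagatorsI] (1.18) p. 20, (1.69)
p. 29 are TEXT LOCATIONS for the objects.  NOT (CONV-C), NEVER «G-an2-4 closed», NOT NE2, NOT D1, NOT BetaPertH, NOT continuum, NOT Clay; not
in print — our bookkeeping.  HONEST DEPENDENCY: continuum YM on T⁴ ⇐ BetaPertH ∧ nine spine estimates (0/9 proved); BetaPertH ⇐ (D1) ∧ (D4)
∧ CAP+tail; G-an2-4 gates asym, D1 and NE2/3/4.
-/

noncomputable section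

open scoped BigOperators ComplexConjugate Matrix

namespace Summit.QuantumFields.BalabanUV.Beta.GAN24.StaircaseAveragingDefect

open Literature.MathematicalPhysics.QuantumFieldTheory.Balaban1983to89
open B5Prop11Plancherel (Tor fine unitVec)
open B5Block118 (tstep tstep_zero bpt QvOp QvOp_mulVec lineSum)
open B5Blocks16 (blockOf)
open B5DeltaA169 (QvAdj)
open Summit.QuantumFields.BalabanUV.T4Continuum.BalabanAveragedTowerModes (par)
open Summit.QuantumFields.BalabanUV.T4Continuum.BalabanLineAverage (shiftT)
open Summit.QuantumFields.BalabanUV.T4Continuum.KingPairingPlantedLaw (JK sqrt_facts)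
open Summit.QuantumFields.BalabanUV.T4Continuum.BlockPairingGeometry (parT JK_apply)
open Summit.QuantumFields.BalabanUV.T4Continuum.LineAveragingPairing (cL cL_eq sqrt_smul_QvOp_mul_JK lineSum_shiftT_sub)
open Summit.QuantumFields.BalabanUV.Beta.GAN24.StaircaseLaplacianDefect (piF norm_piF_le)
open Summit.QuantumFields.BalabanUV.Beta.GAN24.StaircaseLineSumDefect (QvAdj_mulVec_apply QvAdj_succ_sub_stair)

variable {d : ℕ} (N R : ℕ) [NeZero N] [NeZero R] (M : Fin d → ℕ) [hM : ∀ μ, NeZero (M μ)]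

omit [NeZero N] hM in
/-- `0 ≤ (R − 1)∕(R·N)` for `R, N ≥ 1`. [folklore] -/
theorem ratio_nonneg : 0 ≤ ((R : ℝ) - 1) / ((R : ℝ) * N) := by
  have hR : (1 : ℝ) ≤ R := by exact_mod_cast Nat.one_le_iff_ne_zero.mpr (NeZero.ne R)
  exact div_nonneg (by linarith) (by positivity)

/-! ## §1 The componentwise staircase `J ⊗ 1` -/

/-- **the componentwise staircase** `J ⊗ 1`: `((J⊗1)u)(x′, μ) = u(par x′, μ)` (King's block parent `par`, component unchanged), as a
`0∕1` matrix from level-`N` vector fields to level-`RN` vector fields. [folklore] -/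
def stairV : Matrix (Tor (fine (R * N) M) × Fin d) (Tor (fine N M) × Fin d) ℂ :=
  fun i j => if parT N R M i = j then 1 else 0

omit [NeZero R] in
/-- `((J⊗1)u)(i) = u(par i.1, i.2)`. [folklore] -/
theorem stairV_mulVec (u : Tor (fine N M) × Fin d → ℂ) (i : Tor (fine (R * N) M) × Fin d) :
    (stairV N R M *ᵥ u) i = u (par N R M i.1, i.2) := by
  simp only [Matrix.mulVec, dotProduct, stairV, ite_mul, one_mul, zero_mul]
  rw [Finset.sum_ite_eq]
  simp [parT]

omit [NeZero R] in
/-- `(J⊗1)u` as a function. [folklore] -/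
theorem stairV_mulVec_eq (u : Tor (fine N M) × Fin d → ℂ) :
    stairV N R M *ᵥ u = fun i => u (par N R M i.1, i.2) :=
  funext (stairV_mulVec N R M u)

omit [NeZero R] in
/-- `|(J⊗1)u| ≤ |u|_∞`. [folklore] -/
theorem norm_stairV_mulVec_le (u : Tor (fine N M) × Fin d → ℂ) (b : ℝ) (hu : ∀ j, ‖u j‖ ≤ b)
    (i : Tor (fine (R * N) M) × Fin d) : ‖(stairV N R M *ᵥ u) i‖ ≤ b := by
  rw [stairV_mulVec]; exact hu _

/-- `J ⊗ 1 = √(R^d)·J_R` (King's isometric injection `KingPairingPlantedLaw.JK` un-normalised). [folklore] -/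
theorem stairV_eq_smul_JK : stairV N R M = (((Real.sqrt ((R : ℝ) ^ d)) : ℝ) : ℂ) • JK N R M := by
  ext i j
  obtain ⟨_, hss⟩ := sqrt_facts (d := d) R
  have hRd : ((R : ℂ) ^ d) ≠ 0 := pow_ne_zero _ (by exact_mod_cast NeZero.ne R)
  rw [Matrix.smul_apply, smul_eq_mul, JK_apply, ← mul_assoc, ← mul_assoc, hss, mul_inv_cancel₀ hRd, one_mul, stairV]

/-! ## §2 The forward defect `E₁ = Q_{RN}(J⊗1) − Q_N` -/

/-- **the forward averaging defect** `E₁ := Q_{RN}·(J⊗1) − Q_N` (unit-lattice bond fields ← level-`N` vector fields). [folklore] -/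
def fwdDefect : Matrix (Tor M × Fin d) (Tor (fine N M) × Fin d) ℂ :=
  QvOp (R * N) M * stairV N R M - QvOp N M

/-- **`Q_{RN}·(J⊗1) = Q_N·(1 + c_R(S₁ − 1))`** — NE2 leaf-06's pairing identity `sqrt_smul_QvOp_mul_JK` read through `J⊗1 = √(R^d)·J_R`.
[folklore] -/
theorem QvOp_mul_stairV :
    QvOp (R * N) M * stairV N R M = QvOp N M * (1 + cL R • (shiftT (fine N M) 1 - 1)) := by
  rw [stairV_eq_smul_JK, Matrix.mul_smul, sqrt_smul_QvOp_mul_JK]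

/-- **`E₁ = c_R • Q_N(S₁ − 1)`**, `c_R = (R−1)∕(2R)`, `(S₁f)(x, μ) = f(x + e_μ, μ)` the own-direction fine shift. [folklore] -/
theorem fwdDefect_eq : fwdDefect N R M = cL R • (QvOp N M * (shiftT (fine N M) 1 - 1)) := by
  rw [fwdDefect, QvOp_mul_stairV, Matrix.mul_add, Matrix.mul_one, Matrix.mul_smul, add_sub_cancel_left]

/-- **THE FORWARD DEFECT IN POSITION SPACE, TELESCOPED**: `(E₁f)_μ(y) = c_R·N^{−(d+1)}·Σ_{x ∈ B_N(y)} (f_μ(x + N·e_μ) − f_μ(x))` — the contour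
sum of `S₁f − f` over the `N` bonds of a block line telescopes to a difference at UNIT distance (`lineSum_shiftT_sub`). [folklore] -/
theorem fwdDefect_mulVec_apply (f : Tor (fine N M) × Fin d → ℂ) (y : Tor M) (μ : Fin d) :
    (fwdDefect N R M *ᵥ f) (y, μ) = cL R * (1 / (N : ℂ) ^ (d + 1) *
      ∑ j : Fin d → Fin N, (f (bpt N M y j + tstep (fine N M) μ N, μ) - f (bpt N M y j, μ))) := by
  rw [fwdDefect_eq, Matrix.smul_mulVec, Pi.smul_apply, smul_eq_mul, ← Matrix.mulVec_mulVec, Matrix.sub_mulVec,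
    Matrix.one_mulVec, QvOp_mulVec]
  congr 2
  refine Finset.sum_congr rfl fun j _ => ?_
  rw [lineSum_shiftT_sub, tstep_zero, add_zero]

/-- **`|E₁f| ≤ ((R−1)∕(RN))·|f|_∞`** — the forward defect is `O(η′·(R−1))` with NO derivative on `f`. [folklore] -/
theorem norm_fwdDefect_mulVec_le (f : Tor (fine N M) × Fin d → ℂ) (b : ℝ) (hf : ∀ j, ‖f j‖ ≤ b) (i : Tor M × Fin d) :
    ‖(fwdDefect N R M *ᵥ f) i‖ ≤ (((R : ℝ) - 1) / ((R : ℝ) * N)) * b := by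
  obtain ⟨y, μ⟩ := i
  have hR : 0 < R := Nat.pos_of_ne_zero (NeZero.ne R)
  have hR1 : (1 : ℝ) ≤ R := by exact_mod_cast hR
  have hN : (0 : ℝ) < N := by exact_mod_cast Nat.pos_of_ne_zero (NeZero.ne N)
  have hb : 0 ≤ b := (norm_nonneg _).trans (hf (bpt N M y (fun _ => 0), μ))
  rw [fwdDefect_mulVec_apply, norm_mul, norm_mul, cL_eq R hR]
  have h1 : ‖((R : ℂ) - 1) / (2 * R)‖ = ((R : ℝ) - 1) / (2 * R) := by
    rw [show ((R : ℂ) - 1) / (2 * R) = ((((R : ℝ) - 1) / (2 * R) : ℝ) : ℂ) by push_cast; ring, Complex.norm_real,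
      Real.norm_of_nonneg (div_nonneg (by linarith) (by positivity))]
  have h2 : ‖(1 / (N : ℂ) ^ (d + 1))‖ = 1 / (N : ℝ) ^ (d + 1) := by
    rw [norm_div, norm_one, norm_pow, Complex.norm_natCast]
  have h3 : ‖∑ j : Fin d → Fin N, (f (bpt N M y j + tstep (fine N M) μ N, μ) - f (bpt N M y j, μ))‖ ≤ (N : ℝ) ^ d * (2 * b) := by
    calc _ ≤ ∑ j : Fin d → Fin N, ‖f (bpt N M y j + tstep (fine N M) μ N, μ) - f (bpt N M y j, μ)‖ := norm_sum_le _ _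
      _ ≤ ∑ _j : Fin d → Fin N, 2 * b :=
          Finset.sum_le_sum fun j _ => (norm_sub_le _ _).trans (by linarith [hf (bpt N M y j + tstep (fine N M) μ N, μ), hf (bpt N M y j, μ)])
      _ = (N : ℝ) ^ d * (2 * b) := by
          rw [Finset.sum_const, Finset.card_univ, Fintype.card_fun, Fintype.card_fin, Fintype.card_fin, nsmul_eq_mul]; push_cast; ring
  rw [h1, h2]
  calc ((R : ℝ) - 1) / (2 * R) * (1 / (N : ℝ) ^ (d + 1) * ‖∑ j : Fin d → Fin N,
          (f (bpt N M y j + tstep (fine N M) μ N, μ) - f (bpt N M y j, μ))‖)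
      ≤ ((R : ℝ) - 1) / (2 * R) * (1 / (N : ℝ) ^ (d + 1) * ((N : ℝ) ^ d * (2 * b))) :=
        mul_le_mul_of_nonneg_left (mul_le_mul_of_nonneg_left h3 (by positivity)) (div_nonneg (by linarith) (by positivity))
    _ = (((R : ℝ) - 1) / ((R : ℝ) * N)) * b := by field_simp; ring

/-! ## §3 The adjoint defect `E₂ = Q*_{RN} − (J⊗1)Q*_N` -/

/-- **the adjoint averaging defect** `E₂ := Q*_{RN} − (J⊗1)·Q*_N` (level-`RN` vector fields ← unit-lattice bond fields). [folklore] -/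
def adjDefect : Matrix (Tor (fine (R * N) M) × Fin d) (Tor M × Fin d) ℂ :=
  QvAdj (R * N) M - stairV N R M * QvAdj N M

/-- **THE ADJOINT DEFECT IN POSITION SPACE** (Part 1's sawtooth): `(E₂B)(x′, μ) = π^F_μ(x′)·(B_μ(y) − B_μ(y − e_μ))`, `y = blockOf_{RN} x′`.
[folklore] -/
theorem adjDefect_mulVec_apply (B : Tor M × Fin d → ℂ) (x : Tor (fine (R * N) M)) (μ : Fin d) :
    (adjDefect N R M *ᵥ B) (x, μ)
      = piF N R M μ x * (B (blockOf (R * N) M x, μ) - B (blockOf (R * N) M x - unitVec M μ, μ)) := by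
  rw [adjDefect, Matrix.sub_mulVec, Pi.sub_apply, ← Matrix.mulVec_mulVec, stairV_mulVec, QvAdj_succ_sub_stair]

/-- **`|E₂B| ≤ 2((R−1)∕(RN))·|B|_∞`**. [folklore] -/
theorem norm_adjDefect_mulVec_le (B : Tor M × Fin d → ℂ) (b : ℝ) (hB : ∀ j, ‖B j‖ ≤ b) (i : Tor (fine (R * N) M) × Fin d) :
    ‖(adjDefect N R M *ᵥ B) i‖ ≤ 2 * (((R : ℝ) - 1) / ((R : ℝ) * N)) * b := by
  obtain ⟨x, μ⟩ := i
  rw [adjDefect_mulVec_apply, norm_mul]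
  have h2 : ‖B (blockOf (R * N) M x, μ) - B (blockOf (R * N) M x - unitVec M μ, μ)‖ ≤ 2 * b :=
    (norm_sub_le _ _).trans (by linarith [hB (blockOf (R * N) M x, μ), hB (blockOf (R * N) M x - unitVec M μ, μ)])
  calc _ ≤ (((R : ℝ) - 1) / ((R : ℝ) * N)) * (2 * b) := mul_le_mul (norm_piF_le N R M μ x) h2 (norm_nonneg _) (ratio_nonneg N R)
    _ = _ := by ring

/-! ## §4 The elementary sup bounds of `Q` and `Q*` -/

section OneLevel

variable (n : ℕ) [NeZero n]

/-- **`|Q f| ≤ |f|_∞`**: the (1.18) average is a mean (`n^{d+1}` bonds, weights `n^{−(d+1)}`). [folklore] -/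
theorem norm_QvOp_mulVec_le (f : Tor (fine n M) × Fin d → ℂ) (b : ℝ) (hf : ∀ j, ‖f j‖ ≤ b) (i : Tor M × Fin d) :
    ‖(QvOp n M *ᵥ f) i‖ ≤ b := by
  obtain ⟨y, μ⟩ := i
  have hn : (0 : ℝ) < n := by exact_mod_cast Nat.pos_of_ne_zero (NeZero.ne n)
  have hb : 0 ≤ b := (norm_nonneg _).trans (hf (bpt n M y (fun _ => 0), μ))
  rw [QvOp_mulVec, norm_mul]
  have h1 : ‖(1 / (n : ℂ) ^ (d + 1))‖ = 1 / (n : ℝ) ^ (d + 1) := by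
    rw [norm_div, norm_one, norm_pow, Complex.norm_natCast]
  have h2 : ‖∑ j : Fin d → Fin n, lineSum n M f (bpt n M y j) μ‖ ≤ (n : ℝ) ^ d * ((n : ℝ) * b) := by
    calc _ ≤ ∑ j : Fin d → Fin n, ‖lineSum n M f (bpt n M y j) μ‖ := norm_sum_le _ _
      _ ≤ ∑ _j : Fin d → Fin n, (n : ℝ) * b := Finset.sum_le_sum fun j _ => by
          unfold lineSum
          calc _ ≤ ∑ t : Fin n, ‖f (bpt n M y j + tstep (fine n M) μ t, μ)‖ := norm_sum_le _ _
            _ ≤ ∑ _t : Fin n, b := Finset.sum_le_sum fun t _ => hf _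
            _ = (n : ℝ) * b := by rw [Finset.sum_const, Finset.card_univ, Fintype.card_fin, nsmul_eq_mul]
      _ = (n : ℝ) ^ d * ((n : ℝ) * b) := by
          rw [Finset.sum_const, Finset.card_univ, Fintype.card_fun, Fintype.card_fin, Fintype.card_fin, nsmul_eq_mul]; push_cast; ring
  rw [h1]
  calc 1 / (n : ℝ) ^ (d + 1) * ‖∑ j : Fin d → Fin n, lineSum n M f (bpt n M y j) μ‖
      ≤ 1 / (n : ℝ) ^ (d + 1) * ((n : ℝ) ^ d * ((n : ℝ) * b)) := mul_le_mul_of_nonneg_left h2 (by positivity)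
    _ = b := by field_simp; ring

/-- **`|Q* B| ≤ |B|_∞`**: `(Q*B)_μ(x) = (1/n)·Σ_{t<n} B_μ(blockOf(x − t·e_μ))` is a mean of `n` values of `B`. [folklore] -/
theorem norm_QvAdj_mulVec_le (B : Tor M × Fin d → ℂ) (b : ℝ) (hB : ∀ j, ‖B j‖ ≤ b) (i : Tor (fine n M) × Fin d) :
    ‖(QvAdj n M *ᵥ B) i‖ ≤ b := by
  obtain ⟨x, μ⟩ := i
  have hn : (0 : ℝ) < n := by exact_mod_cast Nat.pos_of_ne_zero (NeZero.ne n)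
  have hb : 0 ≤ b := (norm_nonneg _).trans (hB (blockOf n M x, μ))
  rw [QvAdj_mulVec_apply, norm_mul]
  have h1 : ‖(1 / (n : ℂ))‖ = 1 / (n : ℝ) := by rw [norm_div, norm_one, Complex.norm_natCast]
  have h2 : ‖∑ t : Fin n, B (blockOf n M (x - tstep (fine n M) μ t), μ)‖ ≤ (n : ℝ) * b := by
    calc _ ≤ ∑ t : Fin n, ‖B (blockOf n M (x - tstep (fine n M) μ t), μ)‖ := norm_sum_le _ _
      _ ≤ ∑ _t : Fin n, b := Finset.sum_le_sum fun t _ => hB _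
      _ = (n : ℝ) * b := by rw [Finset.sum_const, Finset.card_univ, Fintype.card_fin, nsmul_eq_mul]
  rw [h1]
  calc 1 / (n : ℝ) * ‖∑ t : Fin n, B (blockOf n M (x - tstep (fine n M) μ t), μ)‖ ≤ 1 / (n : ℝ) * ((n : ℝ) * b) :=
        mul_le_mul_of_nonneg_left h2 (by positivity)
    _ = b := by field_simp

end OneLevel

/-! ## §5 The mass term `Q*Q` against the staircase -/

/-- **`Q′*Q′·(J⊗1) − (J⊗1)·Q*Q = E₂·Q + Q′*·E₁`** — the two-level defect of the mass term `Π = Q*Q` of Bałaban's `Δ_a` (1.69) is the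
adjoint defect read against `Q_N` plus the forward defect spread by `Q*_{RN}` (pure algebra: `Q′(J⊗1) = Q + E₁`, `(J⊗1)Q* = Q′* − E₂`).
[folklore] -/
theorem Pi_stairV_defect :
    QvAdj (R * N) M * QvOp (R * N) M * stairV N R M - stairV N R M * (QvAdj N M * QvOp N M)
      = adjDefect N R M * QvOp N M + QvAdj (R * N) M * fwdDefect N R M := by
  rw [adjDefect, fwdDefect, Matrix.sub_mul, Matrix.mul_sub, Matrix.mul_assoc, Matrix.mul_assoc]
  abel

end Summit.QuantumFields.BalabanUV.Beta.GAN24.StaircaseAveragingDefect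

end
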